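import Summits.HodgeConjecture.HodgeConjecture.Theorems.WeilTypeLadderBlochSeed
import Summits.HodgeConjecture.HodgeConjecture.Theorems.WeilTypeLadderDegenerationUp
import Summits.HodgeConjecture.HodgeConjecture.Theorems.PadicSemiregularLiftHodgeAbelianVarietiesStubDescendPrym
import Summits.HodgeConjecture.HodgeConjecture.Theorems.PadicSemiregularLiftHodgeAbelianVarietiesStubWeilSectorOffReach
import Summits.Ventures.HSemireg.SheafSeed
import HarnessLib

/-!
# HSemireg venture · general structure (G4) — TRACK W: uniform SEEDS on the Weil components ⟹ rung R∞ (Weil CLASSES), `HC_CM`-free;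
# cofinal seed levels, the one-step-down edge, and the one-anchor SHEAF door

HONEST FRAMING (speculative tier of cell `pub-hsemireg`, team «general structure», seat G4; verbatim the cell's wording rule):
**nothing here says `HC_AV` or `HC_CM` is proved; every implication carries its named hypotheses.** No `sorry`, no new axiom;
axioms `propext`, `Classical.choice`, `Quot.sound`. Markman 2025 (arXiv:2502.03415) is a PREPRINT, cited for statements only.

This is Track W of the team lead's ruling GS-R1 (`general-structure/PLAN.md`): the `HC_CM`-FREE track whose inputs are what the
team's tables and coverage list literally produce — ONE semiregular representative (a «seed») of a class `q·hᴺ + w` on ONE split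
(hyperbolic) CM anchor per `(level N, field ℚ(√-d))` — and whose honest terminus is rung R∞
`WeilTypeLadder.WeilClassesImaginaryQuadratic` (the WEIL CLASSES are algebraic on every `ℚ(√-d)`-Weil abelian `2n`-fold, `n ≥ 2`),
NOT `HodgeWeilType` (= `HC_AV`, ring 2's exactness; RED-GS finding GS-1). Track S (`HC_AV` modulo `HC_CM` and the uniform lift
at CM fibres) is the companions `GeneralStructureWiring{,Bloch,PrimitiveMiddle,Anchor}.lean`.

§1 is TRANSPLANTED from the ring-2 transport seat's kernel-checked review sketch `general-structure/transport/WeilLadderCofinalSeeds.lean`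
(planner-pub-hodge-ring2-transport g121, 2026-08-22, sha256/16 f60c99908d67a191; «gs-g4 holds the pen and may transplant»), renamed
into this namespace; §2 adds the SHEAF door the review marked WANTED, which the venture's own `SheafSeed.lean` (p3) makes a three-line
composition. The tree's own W1 rows are NOT re-exported (gate review p319177: no duplicate declarations) — cite them BY NAME:
`WeilTypeLadder.weilClassesImaginaryQuadratic_of_reach_of_blochSpread_of_seeds` (W1: seeds in dimension 6 for `4d` and in every
`2n ≥ 8` ⟹ R∞) and `WeilTypeLadder.weilSixfolds_of_reach_of_blochSpread_of_seeds_four` (W1(4): eightfold seeds ⟹ `WeilSixfolds`, the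
g = 6 team's object), both in `Theorems/WeilTypeLadderBlochSeed.lean`.

* §1 ONE-STEP-DOWN is a tree theorem in every half-dimension (`PrymCanonicalZ3SplitSeeds.Stubs.Descend.stub_descend`: split
  `ℚ(√-d)`-Weil `2(n+1)`-folds ⟹ ALL `ℚ(√-d)`-Weil `2n`-folds; partner Weil surface + Schoen 1998 §10); iterated:
  `weilAlgebraicAll_of_splitHyperplane_lt` (a split level `N` covers every cell `(ℚ(√-d), n, any discriminant)`, `2 ≤ n < N`, SAME `d`);
  `splitHyperplane_of_reach_of_blochSpread_of_seed` (door A at level `N`: reach ∧ Bloch 7.4 at `(2N, N)` ∧ ONE hyperbolic Bloch seed);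
  W1-COFINAL `weilClassesImaginaryQuadratic_of_reach_of_blochSpread_of_cofinalSeeds` and W1-ODD `…_of_oddSeeds` (seeds at all odd levels
  `N ≥ 5` ⟹ R∞ with NO floor fact and NO `n = 3` door); `weilAlgebraicAll_below_of_reach_of_blochSpread_of_seeds`.
* §2 `HasHyperbolicBFSheafSeed C N d I` (the anchor binders of `HasHyperbolicBlochSeed N d` with the lci seed replaced by p3's
  `HasBFSheafSeedAt C N I P h_K w`: an `I`-semiregular FINITE LOCALLY FREE `ℰ₀` with `ch_N = q·hᴺ + w`, `ch_p = c_p·hᵖ` for `p ∈ I ∖ {N}`, on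
  every model of the anchor) and `hasLocallyAlgebraicWeilAnchor_of_BF_of_hyperbolicBFSheafSeed` (BF 5.1 ⟹ the local anchor), hence the
  sheaf versions of door A and of W1-COFINAL. CAVEAT C1 (transport review T-R4; numbers, not adjectives): the tree renders BF Thm. 5.1 for
  FINITE LOCALLY FREE `ℰ₀` ONLY (`SemiregularVariationalHodgeISemiregular.lean`, gap G44: coherent / perfect-complex versions not rendered) —
  ideal sheaves `I_Z`, `I_Z ⊠ I_{Z'}^∨`, secant complexes instantiate NEITHER this door NOR the sheaf forms of Track S as typed; they need
  either a locally free (twisted) replacement, or the lci door (Bloch), or an explicitly labelled BF-for-complexes binder. Never a hidden conversion.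

SCOPE: imaginary quadratic `K` only. For CM fields with `[K:ℚ] > 2` (`WeilTypeLadder.WeilClassesCMField`, coverage block G3b) the tree has
NO descent edge (no partner Weil surface); with seeds over ALL CM fields AND André 1992 the terminus would be `HC_CM` itself (ring 2's
`HC_CM_iff_weilRungs_of_andre_of_transport`) — not typed here.

## References (bib keys)

Bloch1972Semiregularity (Thm. 7.4, Remark 7.5), BuchweitzFlenner2003 (§5 Thm. 5.1), Deligne1982HodgeCycles (proof of Thm. 4.8),
Schoen1998HodgeWeilAddendum (§10), vanGeemen1994HodgeAV (5.2–5.5), Weil1977HodgeRing (§3), Markman2025SecantWeil (§1.5; preprint),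
Markman2025SurveySecant (§11.5 Step 2; preprint).
-/

noncomputable section

open CategoryTheory

namespace Summit.Ventures.HSemireg.GeneralStructure

open Literature.AlgebraicGeometry Literature.AlgebraicGeometry.Motives
open Literature.AlgebraicGeometry.HodgeTheory
open Summit.HodgeConjecture.HodgeConjecture
open Summit.HodgeConjecture.HodgeConjecture.WeilTypeLadder
open Summit.HodgeConjecture.HodgeConjecture.Cruxes.HodgeAbelianVarieties.EStepSecantInduction
open Summit.HodgeConjecture.HodgeConjecture.Cruxes.HodgeAbelianVarieties.PrymCanonicalZ3SplitSeeds.Stubs.Descend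
  (stub_descend)
open Summit.HodgeConjecture.HodgeConjecture.Cruxes.HodgeAbelianVarieties.PrymCanonicalZ3SplitSeeds.Stubs.WeilSectorOffReach
  (splitHyperplane_of_weilAlgebraicAll)
open Summit.Ventures.HSemireg (HasBFSheafSeedAt weilAnchorLocalClause_of_BF_of_sheafSeedAt)

/-! ### §1 Cofinal seed levels (transplanted from the transport seat's review sketch, kernel-checked there and here) -/

/-- **Door A at ONE level `(N, d)`**: Deligne's hyperbolic reach ∧ Bloch's class-level theorem at `(2N, N)` ∧ ONE hyperbolic Bloch seed
⟹ the split `ℚ(√-d)`-Weil `2N`-folds are algebraic (the tree has the instances `N = 3`, `N = 4`). [cite: Bloch1972Semiregularity, Thm. (7.4) and Remark (7.5)]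
[cite: Deligne1982HodgeCycles, proof of Thm. 4.8] -/
theorem splitHyperplane_of_reach_of_blochSpread_of_seed (hF : weilFamilyReach_hyperbolic) {N d : ℕ}
    (hN : 1 ≤ N) (hd : 0 < d) (hB : BlochSemiregularSpread (2 * N) N) (hS : HasHyperbolicBlochSeed N d) :
    Stubs.WeilAlgebraicSplitHyperplane N d := by
  intro A φ e a hA hφ ha ha0 hhyp c hcW _ _
  exact weilClasses_algebraic_hyperbolic_of_localAnchor N d hN hd
    (hasLocallyAlgebraicWeilAnchor_of_blochSpread_of_hyperbolicBlochSeed hB hS) hF A φ hA hφ e a ha ha0 hhyp hcW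

/-- **ITERATED DESCENT (same `d`)**: split `ℚ(√-d)`-Weil `2(n+1+k)`-folds algebraic ⟹ ALL `ℚ(√-d)`-Weil `2n`-folds algebraic, every
`k ≥ 0` — `stub_descend` iterated `k + 1` times through the tree's restriction `Stubs.WeilSectorOffReach.splitHyperplane_of_weilAlgebraicAll`. [cite: Schoen1998HodgeWeilAddendum, §10 (Proposition)] [cite: Markman2025SurveySecant, §11.5 Step 2 (preprint)] -/
theorem weilAlgebraicAll_of_splitHyperplane_above :
    ∀ k n d : ℕ, 2 ≤ n → 0 < d → Stubs.WeilAlgebraicSplitHyperplane (n + 1 + k) d → WeilAlgebraicAll n d := by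
  intro k
  induction k with
  | zero => intro n d hn hd h; exact stub_descend n d hn hd h
  | succ k ih =>
    intro n d hn hd h
    refine stub_descend n d hn hd (splitHyperplane_of_weilAlgebraicAll (ih (n + 1) d (by omega) hd ?_))
    have e : n + 1 + (k + 1) = n + 1 + 1 + k := by omega
    rw [e] at h
    exact h

/-- **COVERAGE OF ONE SEED LEVEL**: a split level `N` for `d` covers every cell `(ℚ(√-d), n, any discriminant)` with `2 ≤ n < N`
(bookkeeping form for the coverage table's column; SAME `d` only, never upward). [cite: Schoen1998HodgeWeilAddendum, §10 (Proposition)] -/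
theorem weilAlgebraicAll_of_splitHyperplane_lt {N n d : ℕ} (hn : 2 ≤ n) (hnN : n < N) (hd : 0 < d)
    (h : Stubs.WeilAlgebraicSplitHyperplane N d) : WeilAlgebraicAll n d := by
  obtain ⟨k, rfl⟩ : ∃ k, N = n + 1 + k := ⟨N - (n + 1), by omega⟩
  exact weilAlgebraicAll_of_splitHyperplane_above k n d hn hd h

/-- **COFINAL SPLIT LEVELS ⟹ R∞** (`WeilTypeLadder.WeilClassesImaginaryQuadratic`): if for every `n ≥ 2` some level `N > n` has ALL its
split `ℚ(√-d)`-Weil `2N`-folds algebraic for every `d`, Weil's question for imaginary quadratic fields follows — no floor fact is used.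
[cite: Weil1977HodgeRing, §3] [cite: Schoen1998HodgeWeilAddendum, §10] -/
theorem weilClassesImaginaryQuadratic_of_cofinal_splitHyperplane
    (h : ∀ n : ℕ, 2 ≤ n → ∃ N : ℕ, n < N ∧ ∀ d : ℕ, 0 < d → Stubs.WeilAlgebraicSplitHyperplane N d) :
    WeilClassesImaginaryQuadratic := by
  intro n hn d hd A φ hA _ hφ c hc hnn hcW
  obtain ⟨N, hnN, hN⟩ := h n hn
  exact weilAlgebraicAll_of_splitHyperplane_lt hn hnN hd (hN d hd) A φ hA hφ c hcW hc hnn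

/-- **W1-COFINAL (abstract seed-level predicate `L`)**: Deligne's reach ∧ Bloch's class-level theorem at every seed level ∧ one hyperbolic
Bloch seed per `(seed level, d)` ∧ seed levels cofinal ⟹ R∞. `HC_CM`-FREE. [cite: Bloch1972Semiregularity, Thm. (7.4) and Remark (7.5)]
[cite: Deligne1982HodgeCycles, proof of Thm. 4.8] [cite: Schoen1998HodgeWeilAddendum, §10 (Proposition)] -/
theorem weilClassesImaginaryQuadratic_of_reach_of_blochSpread_of_cofinalSeeds (hF : weilFamilyReach_hyperbolic)
    (L : ℕ → Prop) (hcof : ∀ n : ℕ, 2 ≤ n → ∃ N : ℕ, n < N ∧ L N)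
    (hB : ∀ N : ℕ, L N → BlochSemiregularSpread (2 * N) N)
    (hS : ∀ N : ℕ, L N → ∀ d : ℕ, 0 < d → HasHyperbolicBlochSeed N d) : WeilClassesImaginaryQuadratic :=
  weilClassesImaginaryQuadratic_of_cofinal_splitHyperplane fun n hn ↦ by
    obtain ⟨N, hnN, hL⟩ := hcof n hn
    exact ⟨N, hnN, fun d hd ↦
      splitHyperplane_of_reach_of_blochSpread_of_seed hF (by omega) hd (hB N hL) (hS N hL d hd)⟩

/-- **W1-ODD**: reach ∧ Bloch at `(2N, N)` and one hyperbolic Bloch seed per `d` at every ODD `N = 2m+1 ≥ 5` ⟹ R∞ (level `5` already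
covers `n = 2, 3, 4`; the `n = 3` door with its `4·d` twist and the floor facts are NOT needed). [cite: Bloch1972Semiregularity, Thm. (7.4) and Remark (7.5)]
[cite: Deligne1982HodgeCycles, proof of Thm. 4.8] [cite: Schoen1998HodgeWeilAddendum, §10 (Proposition)] -/
theorem weilClassesImaginaryQuadratic_of_reach_of_blochSpread_of_oddSeeds (hF : weilFamilyReach_hyperbolic)
    (hB : ∀ m : ℕ, 2 ≤ m → BlochSemiregularSpread (2 * (2 * m + 1)) (2 * m + 1))
    (hS : ∀ m : ℕ, 2 ≤ m → ∀ d : ℕ, 0 < d → HasHyperbolicBlochSeed (2 * m + 1) d) :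
    WeilClassesImaginaryQuadratic :=
  weilClassesImaginaryQuadratic_of_reach_of_blochSpread_of_cofinalSeeds hF (fun N ↦ ∃ m, 2 ≤ m ∧ N = 2 * m + 1)
    (fun n hn ↦ ⟨2 * n + 1, by omega, n, hn, rfl⟩)
    (fun N ⟨m, hm, hN⟩ ↦ hN ▸ hB m hm)
    (fun N ⟨m, hm, hN⟩ d hd ↦ hN ▸ hS m hm d hd)

/-- **ONE seed level suffices below it**: reach ∧ Bloch at `(2N, N)` ∧ one hyperbolic seed per `d` at level `N` ⟹ ALL `ℚ(√-d)`-Weil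
`2n`-folds for every `2 ≤ n < N` and every `d` (for `N = 4`: the tree's `weilSixfolds_of_reach_of_blochSpread_of_seeds_four` plus the
fourfolds). [cite: Bloch1972Semiregularity, Thm. (7.4) and Remark (7.5)] [cite: Schoen1998HodgeWeilAddendum, §10 (Proposition)] -/
theorem weilAlgebraicAll_below_of_reach_of_blochSpread_of_seeds (hF : weilFamilyReach_hyperbolic) {N : ℕ}
    (hB : BlochSemiregularSpread (2 * N) N) (hS : ∀ d : ℕ, 0 < d → HasHyperbolicBlochSeed N d)
    {n d : ℕ} (hn : 2 ≤ n) (hnN : n < N) (hd : 0 < d) : WeilAlgebraicAll n d :=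
  weilAlgebraicAll_of_splitHyperplane_lt hn hnN hd
    (splitHyperplane_of_reach_of_blochSpread_of_seed hF (by omega) hd hB (hS d hd))

/-! ### §2 The one-anchor SHEAF door (finite locally free, Buchweitz–Flenner Thm. 5.1) — CAVEAT C1: locally free only -/

/-- **`HasHyperbolicBFSheafSeed C N d I` — a hyperbolic Buchweitz–Flenner SHEAF seed at level `N` for `K = ℚ(√-d)`** (PREDICATE, nothing
asserted; the team's SHEAF-side table rows are its intended witnesses): a complex abelian `2N`-fold `P` with `ψ₀ ≫ ψ₀ = -(d • 𝟙 P)`, a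
projective embedding `e` and a rational `a ≠ 0` with `(P, ψ₀)` of HYPERBOLIC (split) Weil type for `h_K = d·e^*a + ψ₀^*e^*a`, a non-zero
rational class `w` of the Weil plane, and the venture's sheaf seed `HasBFSheafSeedAt C N I P h_K w` (`SheafSeed.lean`: on every model of
`P`, an `I`-semiregular FINITE LOCALLY FREE `ℰ₀`, `N ∈ I`, with `ch_N(ℰ₀) = q·h_Kᴺ + w` and `ch_p(ℰ₀) = c_p·h_Kᵖ` for `p ∈ I`, `p ≠ N`).
Verbatim the anchor binders of the tree's `HasHyperbolicBlochSeed N d` with the lci seed replaced by the sheaf seed. CAVEAT C1: FINITE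
LOCALLY FREE only — the tree's rendering of BF Thm. 5.1 (`BuchweitzFlenner2003_variationalHodge_ISemiregular`) does not cover coherent
sheaves or perfect complexes (gap G44); ideal sheaves / secant complexes are NOT witnesses as typed. [cite: BuchweitzFlenner2003, §5 Thm. 5.1 and §5 (I-semiregular)]
[cite: Markman2025SecantWeil, §1.5 (preprint, unrefereed)] -/
def HasHyperbolicBFSheafSeed (C : ChernCharacterBetti) (N d : ℕ) (I : Finset ℕ) : Prop :=
  ∃ (P : AbelianVariety ℂ) (ψ₀ : P ⟶ P) (e : ProjectiveEmbedding P.X) (a : complexBetti (projectiveSpace e.n ℂ) 2)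
    (w : complexBetti P.X (2 * N)),
    P.dim = 2 * N ∧ ψ₀ ≫ ψ₀ = -(d • 𝟙 P) ∧ IsRationalClass a ∧ a ≠ 0 ∧
    IsHyperbolicWeilType P ψ₀ N
      ((d : ℂ) • complexBetti.map e.ι 2 a + complexBetti.map ψ₀.hom.hom.hom 2 (complexBetti.map e.ι 2 a)) ∧
    w ∈ weilClassesOf P ψ₀ N d ∧ IsRationalClass w ∧ w ≠ 0 ∧
    HasBFSheafSeedAt C N I P
      ((d : ℂ) • complexBetti.map e.ι 2 a + complexBetti.map ψ₀.hom.hom.hom 2 (complexBetti.map e.ι 2 a)) w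

/-- **The sheaf door: `[Buchweitz–Flenner 5.1] ∧ HasHyperbolicBFSheafSeed C N d I ⟹ HasLocallyAlgebraicWeilAnchor N d`** (the un-printed
local input of the hyperbolic reach door, from the refereed germ theorem and ONE locally free `I`-semiregular seed; composition of the
venture's `weilAnchorLocalClause_of_BF_of_sheafSeedAt` with the tree's `hasLocallyAlgebraicWeilAnchor_iff`).
[cite: BuchweitzFlenner2003, §5 Thm. 5.1] [cite: Deligne1982HodgeCycles, proof of Thm. 4.8] -/
theorem hasLocallyAlgebraicWeilAnchor_of_BF_of_hyperbolicBFSheafSeed {C : ChernCharacterBetti} {N d : ℕ} {I : Finset ℕ}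
    (hBF : BuchweitzFlenner2003_variationalHodge_ISemiregular) (hS : HasHyperbolicBFSheafSeed C N d I) :
    HasLocallyAlgebraicWeilAnchor N d := by
  obtain ⟨P, ψ₀, e, a, w, hP, hψ, ha, ha0, hhyp, hwW, hwr, hw0, hseed⟩ := hS
  exact (hasLocallyAlgebraicWeilAnchor_iff N d).2
    ⟨P, ψ₀, e, a, w, hP, hψ, ha, ha0, hhyp, hwW, hwr, hw0, weilAnchorLocalClause_of_BF_of_sheafSeedAt d C hBF hseed⟩

/-- **Door A, sheaf version, at ONE level `(N, d)`**: reach ∧ BF 5.1 ∧ ONE hyperbolic sheaf seed ⟹ split `ℚ(√-d)`-Weil `2N`-folds algebraic.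
[cite: BuchweitzFlenner2003, §5 Thm. 5.1] [cite: Deligne1982HodgeCycles, proof of Thm. 4.8] -/
theorem splitHyperplane_of_reach_of_BF_of_sheafSeed (hF : weilFamilyReach_hyperbolic) {C : ChernCharacterBetti} {N d : ℕ}
    {I : Finset ℕ} (hN : 1 ≤ N) (hd : 0 < d) (hBF : BuchweitzFlenner2003_variationalHodge_ISemiregular)
    (hS : HasHyperbolicBFSheafSeed C N d I) : Stubs.WeilAlgebraicSplitHyperplane N d := by
  intro A φ e a hA hφ ha ha0 hhyp c hcW _ _
  exact weilClasses_algebraic_hyperbolic_of_localAnchor N d hN hd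
    (hasLocallyAlgebraicWeilAnchor_of_BF_of_hyperbolicBFSheafSeed hBF hS) hF A φ hA hφ e a ha ha0 hhyp hcW

/-- **W1-COFINAL, SHEAF seeds**: reach ∧ BF 5.1 ∧ one hyperbolic sheaf seed (some `I`) per `(seed level, d)` ∧ seed levels cofinal ⟹ R∞.
`HC_CM`-FREE; the Bloch input `hB` of the lci version is replaced by the single refereed fact `hBF`. CAVEAT C1 applies (locally free seeds).
[cite: BuchweitzFlenner2003, §5 Thm. 5.1] [cite: Deligne1982HodgeCycles, proof of Thm. 4.8] [cite: Schoen1998HodgeWeilAddendum, §10 (Proposition)] -/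
theorem weilClassesImaginaryQuadratic_of_reach_of_BF_of_cofinalSheafSeeds (hF : weilFamilyReach_hyperbolic)
    (C : ChernCharacterBetti) (hBF : BuchweitzFlenner2003_variationalHodge_ISemiregular)
    (L : ℕ → Prop) (hcof : ∀ n : ℕ, 2 ≤ n → ∃ N : ℕ, n < N ∧ L N)
    (hS : ∀ N : ℕ, L N → ∀ d : ℕ, 0 < d → ∃ I : Finset ℕ, HasHyperbolicBFSheafSeed C N d I) :
    WeilClassesImaginaryQuadratic :=
  weilClassesImaginaryQuadratic_of_cofinal_splitHyperplane fun n hn ↦ by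
    obtain ⟨N, hnN, hL⟩ := hcof n hn
    refine ⟨N, hnN, fun d hd ↦ ?_⟩
    obtain ⟨I, hI⟩ := hS N hL d hd
    exact splitHyperplane_of_reach_of_BF_of_sheafSeed hF (by omega) hd hBF hI

/-- **ONE sheaf-seed level suffices below it**: reach ∧ BF 5.1 ∧ one hyperbolic sheaf seed per `d` at level `N` ⟹ ALL `ℚ(√-d)`-Weil
`2n`-folds, `2 ≤ n < N`. [cite: BuchweitzFlenner2003, §5 Thm. 5.1] [cite: Schoen1998HodgeWeilAddendum, §10 (Proposition)] -/
theorem weilAlgebraicAll_below_of_reach_of_BF_of_sheafSeeds (hF : weilFamilyReach_hyperbolic) {C : ChernCharacterBetti} {N : ℕ}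
    (hBF : BuchweitzFlenner2003_variationalHodge_ISemiregular) (hS : ∀ d : ℕ, 0 < d → ∃ I : Finset ℕ, HasHyperbolicBFSheafSeed C N d I)
    {n d : ℕ} (hn : 2 ≤ n) (hnN : n < N) (hd : 0 < d) : WeilAlgebraicAll n d := by
  obtain ⟨I, hI⟩ := hS d hd
  exact weilAlgebraicAll_of_splitHyperplane_lt hn hnN hd (splitHyperplane_of_reach_of_BF_of_sheafSeed hF (by omega) hd hBF hI)

/-! ## Audit: nothing is decided here

Every theorem above whose conclusion is a Weil rung (`WeilClassesImaginaryQuadratic`, `WeilAlgebraicAll n d`,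
`Stubs.WeilAlgebraicSplitHyperplane N d`, `HasLocallyAlgebraicWeilAnchor N d`) has among its hypotheses SEEDS (`HasHyperbolicBlochSeed`,
`HasHyperbolicBFSheafSeed` — the team's computation targets, OPEN) together with refereed named facts (`weilFamilyReach_hyperbolic`,
`BlochSemiregularSpread`, `BuchweitzFlenner2003_variationalHodge_ISemiregular`). `HC_CM` does not occur. One new `def` (a predicate).
Axiom closures: the three standard axioms only. -/

end Summit.Ventures.HSemireg.GeneralStructure

end
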